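import Mathlib.GroupTheory.Nilpotent
import Literature.Computability.Complexity.Circuit
import HarnessLib

/-!
# Route ConvexRankGates, crux `Capture` (stmt-PneNP-2659), line `csp-spine-meet-to-join`,
# stub `stub_nilpotentReduction`: a coset gate over a NILPOTENT group is an OR of `p`-group gates

Crux (by name): `Summit.PneNP.PneNP.Theses.ConvexRankGates.Capture`; skeleton rev 5 of the line
`csp-spine-meet-to-join` (lead c2, 2026-08-16), stub `stub_nilpotentReduction`.

A *coset gate* with parameter `s` is given by a finite group `G` (`|G| ≤ s`), variables `Fin nv`
(`nv ≤ s`) and constraints `j` = "the restriction of `h : Fin nv → G` to `scope j` lies in the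
left coset `c j • H j`" (`H j ≤ G ^ (r j)`, `|G| ^ (r j) ≤ s`); the gate fires on a selection `v`
of the constraints iff the selected constraints have NO common solution.  This file proves: if `G`
is nilpotent, the gate is the OR of `t ≤ s` coset gates with the same parameter `s` over `p`-GROUPS.

Argument (source: the Sylow decomposition of finite nilpotent groups, Mathlib
`Group.isNilpotent_of_finite_tfae` / `Sylow.directProductOfNormal`): `G ≃* Π_{p ∣ |G|} G_p` with
`G_p` the (product of the) Sylow `p`-subgroups; transporting the data along the isomorphism does
not change solvability (`cosetSat_iff_of_mulEquiv`); over a product of groups of pairwise coprime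
orders an instance is unsolvable iff one of its coordinate projections is (this is the HYPOTHESIS
of the stub — the statement of the neighbouring stub `stub_cosetUnsatCoprimePi`, passed as the
first binder); the projections are coset gates over the `p`-groups `G_p`, `|G_p| ≤ |G| ≤ s`, and
there are `#primeFactors |G| ≤ |G| ≤ s` of them (`cosetGate_or_of_mulEquiv_pi`, stated for an
arbitrary decomposition `G ≃* Π_p F p` into groups of pairwise coprime prime-power orders).
[folklore]
-/

namespace Summit.PneNP.PneNP.Cruxes.Capture.CspSpineMeetToJoin

set_option linter.dupNamespace false -- `Summit.PneNP.PneNP.…`: summit = sub-problem (D-0017)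

open Literature.Computability.Complexity

/-- A finite product of `p`-groups is a `p`-group. [folklore] -/
theorem isPGroup_pi_of_forall {ι : Type*} [Finite ι] {p : ℕ} {M : ι → Type*} [∀ i, Group (M i)]
    (h : ∀ i, IsPGroup p (M i)) : IsPGroup p (∀ i, M i) := by
  intro x
  choose k hk using fun i => h i (x i)
  obtain ⟨K, hK⟩ := Finite.exists_le k
  refine ⟨K, funext fun i => ?_⟩
  rw [Pi.pow_apply, Pi.one_apply, ← Nat.add_sub_of_le (hK i), pow_add, pow_mul, hk, one_pow]

/-- The direct product of the Sylow `p`-subgroups of a finite group `G` (the `p`-th factor of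
Mathlib's `Sylow.directProductOfNormal`) is a `p`-group. [folklore] -/
theorem isPGroup_sylowPi (G : Type) [Group G] [Finite G] (p : ℕ) :
    IsPGroup p (∀ P : Sylow p G, ↥(P : Subgroup G)) :=
  isPGroup_pi_of_forall fun P : Sylow p G => P.isPGroup'

/-- The order of the product of the Sylow `p`-subgroups is a power of `p` (`p` prime).
[folklore] -/
theorem card_sylowPi (G : Type) [Group G] [Finite G] {p : ℕ} (hp : p.Prime) :
    ∃ n : ℕ, Nat.card (∀ P : Sylow p G, ↥(P : Subgroup G)) = p ^ n :=
  haveI := Fact.mk hp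
  IsPGroup.iff_card.mp (isPGroup_sylowPi G p)

/-- The number of prime factors of `|G|` is at most `|G|`. [folklore] -/
theorem card_primeFactors_card_le (G : Type) [Fintype G] :
    Fintype.card ↥(Nat.card G).primeFactors ≤ Fintype.card G :=
  calc Fintype.card ↥(Nat.card G).primeFactors = ((Nat.card G).primeFactors).card :=
        Fintype.card_coe _
    _ ≤ (Finset.Ioc 0 (Nat.card G)).card := Finset.card_le_card fun _ hp =>
        Finset.mem_Ioc.mpr ⟨Nat.pos_of_mem_primeFactors hp, Nat.le_of_mem_primeFactors hp⟩
    _ = Fintype.card G := by simp [Nat.card_eq_fintype_card]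

/-- **Transport of coset-CSP solvability along a group isomorphism** `ψ : A ≃* B`: the instance
`(scope, H, c)` over `A` is solvable on the selection `v` iff the transported instance
`(scope, ψ^{r j} (H j), ψ ∘ c j)` over `B` is. [folklore] -/
theorem cosetSat_iff_of_mulEquiv {A B : Type*} [Group A] [Group B] (ψ : A ≃* B) {nv m : ℕ}
    (r : Fin m → ℕ) (scope : (j : Fin m) → Fin (r j) → Fin nv)
    (H : (j : Fin m) → Subgroup (Fin (r j) → A)) (c : (j : Fin m) → Fin (r j) → A)
    (v : Fin m → Bool) :
    (∃ h : Fin nv → A, ∀ j, v j = true → (c j)⁻¹ * (fun i => h (scope j i)) ∈ H j) ↔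
    ∃ h : Fin nv → B, ∀ j, v j = true →
      (fun i => ψ (c j i))⁻¹ * (fun i => h (scope j i)) ∈
        (H j).map (MulEquiv.piCongrRight fun _ : Fin (r j) => ψ).toMonoidHom := by
  constructor
  · rintro ⟨h, hh⟩
    refine ⟨fun k => ψ (h k), fun j hj => ?_⟩
    rw [Subgroup.mem_map_equiv]
    convert hh j hj using 1
    funext i
    simp
  · rintro ⟨h, hh⟩
    refine ⟨fun k => ψ.symm (h k), fun j hj => ?_⟩
    have hm := hh j hj
    rw [Subgroup.mem_map_equiv] at hm
    convert hm using 1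
    funext i
    simp

/-- **The reduction along an arbitrary coprime decomposition.**  Assume the coprime-product
splitting principle `hW1` (the statement of stub `stub_cosetUnsatCoprimePi`).  If the group `G` of a
coset gate `g` with parameter `s` is isomorphic to a product `Π_p F p` of finite groups of pairwise
coprime orders, each a `q`-group for some prime `q`, indexed by `κ` with `|κ| ≤ s`, then `g` is the
OR of `|κ|` coset gates with parameter `s` over the groups `F p`: the `p`-th one is the image of the
transported instance under the `p`-th projection. [folklore] -/
theorem cosetGate_or_of_mulEquiv_pi
    (hW1 : ∀ (κ : Type) [Fintype κ] [DecidableEq κ] (G : κ → Type) [∀ p, Group (G p)]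
      [∀ p, Fintype (G p)],
      (∀ p q, p ≠ q → (Fintype.card (G p)).Coprime (Fintype.card (G q))) →
      ∀ (nv m : ℕ) (r : Fin m → ℕ) (scope : (j : Fin m) → Fin (r j) → Fin nv)
        (H : (j : Fin m) → Subgroup (Fin (r j) → (∀ p, G p)))
        (c : (j : Fin m) → Fin (r j) → (∀ p, G p)) (v : Fin m → Bool),
        (¬ ∃ h : Fin nv → (∀ p, G p), ∀ j, v j = true →
            (c j)⁻¹ * (fun i => h (scope j i)) ∈ H j) ↔
        ∃ p, ¬ ∃ h : Fin nv → G p, ∀ j, v j = true →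
          (fun i => c j i p)⁻¹ * (fun i => h (scope j i)) ∈
            (H j).map (MonoidHom.compLeft (Pi.evalMonoidHom G p) (Fin (r j))))
    {s : ℕ} {g : GateFn} (h1 : g.1 ≤ s) {G : Type} [Group G] [Fintype G] {nv : ℕ}
    (hG : Fintype.card G ≤ s) (hnv : nv ≤ s) {r : Fin g.1 → ℕ}
    (scope : (j : Fin g.1) → Fin (r j) → Fin nv) (H : (j : Fin g.1) → Subgroup (Fin (r j) → G))
    (c : (j : Fin g.1) → Fin (r j) → G) (hr : ∀ j, Fintype.card G ^ r j ≤ s)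
    (hiff : ∀ v : Fin g.1 → Bool, g.2 v = true ↔
      ¬ ∃ h : Fin nv → G, ∀ j, v j = true → (c j)⁻¹ * (fun i => h (scope j i)) ∈ H j)
    {κ : Type} [Fintype κ] [DecidableEq κ] {F : κ → Type} [∀ p, Group (F p)]
    [∀ p, Fintype (F p)] (ψ : G ≃* (∀ p, F p))
    (hcop : ∀ p q, p ≠ q → (Fintype.card (F p)).Coprime (Fintype.card (F q)))
    (hpg : ∀ p, ∃ q : ℕ, q.Prime ∧ IsPGroup q (F p)) (hκ : Fintype.card κ ≤ s) :
    ∃ (t : ℕ) (f : Fin t → (Fin g.1 → Bool) → Bool), t ≤ s ∧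
      (∀ i, (g.1 ≤ s ∧ ∃ (G : Type) (_ : Group G) (_ : Fintype G) (nv : ℕ),
        (∃ p : ℕ, p.Prime ∧ IsPGroup p G) ∧ Fintype.card G ≤ s ∧ nv ≤ s ∧
        ∃ (r : Fin g.1 → ℕ) (scope : (j : Fin g.1) → Fin (r j) → Fin nv)
          (H : (j : Fin g.1) → Subgroup (Fin (r j) → G)) (c : (j : Fin g.1) → Fin (r j) → G),
          (∀ j, Fintype.card G ^ r j ≤ s) ∧
          ∀ v : Fin g.1 → Bool, f i v = true ↔
            ¬ ∃ h : Fin nv → G, ∀ j, v j = true → (c j)⁻¹ * (fun i => h (scope j i)) ∈ H j)) ∧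
      ∀ v : Fin g.1 → Bool, g.2 v = true ↔ ∃ i, f i v = true := by
  classical
  -- each factor embeds into `G`
  have hcardle : ∀ p, Fintype.card (F p) ≤ Fintype.card G := fun p =>
    Fintype.card_le_of_injective (fun x : F p => ψ.symm (Pi.mulSingle p x))
      (ψ.symm.injective.comp (Pi.mulSingle_injective p))
  -- transport along `ψ`, then split over the coprime factors
  have key := fun v => cosetSat_iff_of_mulEquiv ψ r scope H c v
  have key2 := fun v => hW1 κ F hcop nv g.1 r scope
    (fun j => (H j).map (MulEquiv.piCongrRight fun _ : Fin (r j) => ψ).toMonoidHom)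
    (fun j i => ψ (c j i)) v
  -- enumerate the factors
  set e := Fintype.equivFin κ
  refine ⟨Fintype.card κ, fun i w => decide (¬ ∃ h : Fin nv → F (e.symm i),
      ∀ j, w j = true → (fun k => ψ (c j k) (e.symm i))⁻¹ * (fun k => h (scope j k)) ∈
        ((H j).map (MulEquiv.piCongrRight fun _ : Fin (r j) => ψ).toMonoidHom).map
          (MonoidHom.compLeft (Pi.evalMonoidHom F (e.symm i)) (Fin (r j)))),
    hκ, fun i => ?_, fun w => ?_⟩
  · refine ⟨h1, F (e.symm i), inferInstance, inferInstance, nv, hpg _, (hcardle _).trans hG, hnv,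
      r, scope,
      fun j => ((H j).map (MulEquiv.piCongrRight fun _ : Fin (r j) => ψ).toMonoidHom).map
        (MonoidHom.compLeft (Pi.evalMonoidHom F (e.symm i)) (Fin (r j))),
      fun j k => ψ (c j k) (e.symm i),
      fun j => (Nat.pow_le_pow_left (hcardle _) (r j)).trans (hr j), fun w => ?_⟩
    exact decide_eq_true_iff
  · refine (hiff w).trans <| (not_congr (key w)).trans <| (key2 w).trans <|
      e.exists_congr_left.trans <| exists_congr fun i => ?_
    exact decide_eq_true_iff.symm

/-- **Stub `stub_nilpotentReduction`** (line `csp-spine-meet-to-join`, rev 5).  Hypothesis: the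
statement of the neighbouring stub `stub_cosetUnsatCoprimePi` (over a product of finite groups of
pairwise coprime orders, a coset instance is unsolvable iff one of its coordinate projections is).
Conclusion: a coset gate with parameter `s` over a finite nilpotent group is the OR of `t ≤ s`
coset gates with parameter `s` over `p`-groups — `cosetGate_or_of_mulEquiv_pi` applied to the
Sylow decomposition `Group.isNilpotent_of_finite_tfae` (1 ↔ 5). [folklore] -/
theorem stub_nilpotentReduction :
    (∀ (κ : Type) [Fintype κ] [DecidableEq κ] (G : κ → Type) [∀ p, Group (G p)] [∀ p, Fintype (G p)],
      (∀ p q, p ≠ q → (Fintype.card (G p)).Coprime (Fintype.card (G q))) →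
      ∀ (nv m : ℕ) (r : Fin m → ℕ) (scope : (j : Fin m) → Fin (r j) → Fin nv)
        (H : (j : Fin m) → Subgroup (Fin (r j) → (∀ p, G p))) (c : (j : Fin m) → Fin (r j) → (∀ p, G p))
        (v : Fin m → Bool),
        (¬ ∃ h : Fin nv → (∀ p, G p), ∀ j, v j = true → (c j)⁻¹ * (fun i => h (scope j i)) ∈ H j) ↔
        ∃ p, ¬ ∃ h : Fin nv → G p, ∀ j, v j = true →
          (fun i => c j i p)⁻¹ * (fun i => h (scope j i)) ∈
            (H j).map (MonoidHom.compLeft (Pi.evalMonoidHom G p) (Fin (r j)))) →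
    ∀ (s : ℕ) (g : GateFn), (g.1 ≤ s ∧ ∃ (G : Type) (_ : Group G) (_ : Fintype G) (nv : ℕ),
      Group.IsNilpotent G ∧ Fintype.card G ≤ s ∧ nv ≤ s ∧
      ∃ (r : Fin g.1 → ℕ) (scope : (j : Fin g.1) → Fin (r j) → Fin nv)
        (H : (j : Fin g.1) → Subgroup (Fin (r j) → G)) (c : (j : Fin g.1) → Fin (r j) → G),
        (∀ j, Fintype.card G ^ r j ≤ s) ∧
        ∀ v : Fin g.1 → Bool, g.2 v = true ↔
          ¬ ∃ h : Fin nv → G, ∀ j, v j = true → (c j)⁻¹ * (fun i => h (scope j i)) ∈ H j) →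
      ∃ (t : ℕ) (f : Fin t → (Fin g.1 → Bool) → Bool), t ≤ s ∧
        (∀ i, (g.1 ≤ s ∧ ∃ (G : Type) (_ : Group G) (_ : Fintype G) (nv : ℕ),
          (∃ p : ℕ, p.Prime ∧ IsPGroup p G) ∧ Fintype.card G ≤ s ∧ nv ≤ s ∧
          ∃ (r : Fin g.1 → ℕ) (scope : (j : Fin g.1) → Fin (r j) → Fin nv)
            (H : (j : Fin g.1) → Subgroup (Fin (r j) → G)) (c : (j : Fin g.1) → Fin (r j) → G),
            (∀ j, Fintype.card G ^ r j ≤ s) ∧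
            ∀ v : Fin g.1 → Bool, f i v = true ↔
              ¬ ∃ h : Fin nv → G, ∀ j, v j = true → (c j)⁻¹ * (fun i => h (scope j i)) ∈ H j)) ∧
        ∀ v : Fin g.1 → Bool, g.2 v = true ↔ ∃ i, f i v = true := by
  intro hW1 s g hg
  obtain ⟨h1, G, iG, iF, nv, hnil, hG, hnv, r, scope, H, c, hr, hiff⟩ := hg
  classical
  -- Sylow decomposition of the finite nilpotent group `G` (Mathlib, TFAE 1 ↔ 5)
  obtain ⟨φ⟩ := ((Group.isNilpotent_of_finite_tfae (G := G)).out 0 4).mp hnil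
  haveI hF : ∀ p : ↥(Nat.card G).primeFactors,
      Fintype (∀ P : Sylow (p : ℕ) G, ↥(P : Subgroup G)) := fun p => Fintype.ofFinite _
  have hprime : ∀ p : ↥(Nat.card G).primeFactors, (p : ℕ).Prime := fun p =>
    Nat.prime_of_mem_primeFactors p.2
  refine cosetGate_or_of_mulEquiv_pi hW1 h1 hG hnv scope H c hr hiff φ.symm ?_
    (fun p => ⟨p, hprime p, isPGroup_sylowPi G p⟩) ((card_primeFactors_card_le G).trans hG)
  -- distinct primes: the factors have coprime (prime power) orders
  intro p q hpq
  obtain ⟨a, ha⟩ := card_sylowPi G (hprime p)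
  obtain ⟨b, hb⟩ := card_sylowPi G (hprime q)
  rw [Fintype.card_eq_nat_card, Fintype.card_eq_nat_card, ha, hb]
  exact Nat.coprime_pow_primes _ _ (hprime p) (hprime q) fun h => hpq (Subtype.ext h)

end Summit.PneNP.PneNP.Cruxes.Capture.CspSpineMeetToJoin
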